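import Literature.Topology.FourManifolds.GenericCircleStepAvoid
import Literature.Topology.FourManifolds.IsotopyProofs
import HarnessLib

/-!
# Whitney 1936 for links: componentwise homotopic links of circles in dimension `≥ 4` are
# isotopic as links

Topic `Literature/Topology/FourManifolds`; assembly of `GenericCircleStepAvoid.lean` (Whitney's
general-position argument for one circle moving in the complement of finitely many fixed
curves).  H. Whitney, *Differentiable manifolds*, Ann. of Math. 37 (1936), §II Thm. 6 with
§§8–9 (general position), Milnor, *Lectures on the h-cobordism theorem* (1965), Thm. 8.4 and
Remark (`n ≥ 2m + 2`, here `m = 1`): in a closed manifold `V` of dimension `n ≥ 4`, if two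
smooth links `e₀, e₁ : ι → (S¹ → V)` (finitely many pairwise disjoint smoothly embedded circles)
are componentwise homotopic, then there are smooth isotopies `Fᵢ` from `e₀ i` to `e₁ i` whose
stages form a link at every time (`exists_smoothIsotopy_link_of_homotopic`).  This is the form
in which the attaching circles of several `5`-dimensional 2-handles are moved simultaneously in
the `4`-manifold `∂V` (Andrews–Curtis 1965; Kirby 1989, p. 18: *"attaching circles are unknotted
and unlinked in `S⁴ = ∂B⁵`"*).

**Proof.**  Components are moved one at a time, the others standing still, each move being a
smooth isotopy of one circle in the complement of the other (fixed) components: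
first every `e₀ i` is replaced by a small generic perturbation `ẽ₀ i` (`eg₀` in the code) disjoint from the `e₁ j`,
`j ≠ i` (`exists_smoothIsotopy_perturb_avoiding`, inside the complement of the other
components), then `ẽ₀ k` is moved to `e₁ k` for `k = 0, 1, …` by Whitney's theorem avoiding
the components already at `e₁` and those still at `ẽ₀`
(`exists_smoothIsotopy_circle_of_homotopic_avoiding`).  The bookkeeping (`exists_link_phase_step`) uses the
tree's concatenation `SmoothIsotopy.trans` (`IsotopyProofs.lean`), which runs all components on
the same clock, so that disjointness of the stages is read off phase by phase.  Everything here
is proved; no definitions, no named facts.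

## References

* H. Whitney, *Differentiable manifolds*, Ann. of Math. (2) 37 (1936), §II Thm. 6, §§8–9.
  [Whitney1936]
* J. Milnor, *Lectures on the h-cobordism theorem* (1965), Thm. 8.4 and Remark (PDF p. 56).
  [MilnorHCobordism1965]
* R. C. Kirby, *The topology of 4-manifolds*, LNM 1374 (1989), Ch. I, p. 18. [Kirby1989]
-/

open scoped Manifold ContDiff Topology
open Function Set

noncomputable section

namespace Literature.Topology.FourManifolds

variable {n : ℕ} {V : Type*} [TopologicalSpace V] [ChartedSpace (EuclideanSpace ℝ (Fin n)) V]
  [IsManifold (𝓡 n) ∞ V]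

/-! ### Smooth families of circles as isotopies and homotopies -/

section Families

variable {m : ℕ}

omit [IsManifold (𝓡 n) ∞ V] in
/-- A smooth family of embedded circles `Φ : ℝ → S¹ → V` starting at `f` and with stage `1`
equal to `g`, packaged as a `SmoothIsotopy` from `f` to `g`. [folklore] -/
theorem exists_smoothIsotopy_of_family {f g : (Metric.sphere (0 : EuclideanSpace ℝ (Fin 2)) 1) → V}
    (Φ : ℝ → (Metric.sphere (0 : EuclideanSpace ℝ (Fin 2)) 1) → V)
    (h1 : ContMDiff (𝓘(ℝ, ℝ).prod (𝓡 1)) (𝓡 n) ∞ (uncurry Φ))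
    (h2 : ∀ t, Manifold.IsSmoothEmbedding (𝓡 1) (𝓡 n) ∞ (Φ t)) (h0 : Φ 0 = f) (hg : Φ 1 = g) :
    ∃ F : SmoothIsotopy (𝓡 1) (𝓡 n) f g, F.toFun = Φ :=
  ⟨{ toFun := Φ, contMDiff := h1, isSmoothEmbedding := h2, map_zero := h0, map_one := hg }, rfl⟩

omit [IsManifold (𝓡 n) ∞ V] in
/-- **A smooth isotopy is a homotopy** (restrict the time to `[0, 1]`). [folklore] -/
theorem SmoothIsotopy.homotopic_mk {f g : (Metric.sphere (0 : EuclideanSpace ℝ (Fin 2)) 1) → V}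
    (F : SmoothIsotopy (𝓡 1) (𝓡 n) f g) (hf : Continuous f) (hg : Continuous g) :
    (⟨f, hf⟩ : C(Metric.sphere (0 : EuclideanSpace ℝ (Fin 2)) 1, V)).Homotopic ⟨g, hg⟩ :=
  ⟨{ toFun := fun p => F.toFun (p.1 : ℝ) p.2
     continuous_toFun :=
       F.contMDiff.continuous.comp (continuous_subtype_val.fst'.prodMk continuous_snd)
     map_zero_left := fun u => by
       show F.toFun 0 u = f u
       rw [F.map_zero]
     map_one_left := fun u => by
       show F.toFun 1 u = g u
       rw [F.map_one] }⟩

omit [IsManifold (𝓡 n) ∞ V] in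
/-- Stages of a concatenation are stages of one of the pieces, *with a piece and an inner time
depending only on the outer time* (the clock of `SmoothIsotopy.trans`). [folklore] -/
theorem SmoothIsotopy.trans_toFun_eq {f g h : (Metric.sphere (0 : EuclideanSpace ℝ (Fin 2)) 1) → V}
    (F : SmoothIsotopy (𝓡 1) (𝓡 n) f g) (G : SmoothIsotopy (𝓡 1) (𝓡 n) g h) (t : ℝ) :
    (F.trans G).toFun t = if t ≤ 1 / 2 then F.toFun (concatStep₁ t) else G.toFun (concatStep₂ t) :=
  rfl

omit [IsManifold (𝓡 n) ∞ V] in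
/-- **One phase: a single component moves.**  Let `Φ : Fin m → ℝ → S¹ → V` be smooth families of
embedded circles starting at the `e₀ i`, with pairwise disjoint stages at every time, and let
`F` be a smooth isotopy of the `k`-th current position `Φ k 1` whose stages avoid the current
positions of the other components.  Concatenating `Φ k` with `F`, and the other `Φ i` with
constant isotopies, gives smooth families with pairwise disjoint stages, the same positions at
time `1` except for the `k`-th, which becomes the end of `F`. [folklore] -/
theorem exists_link_phase_step {e₀ : Fin m → (Metric.sphere (0 : EuclideanSpace ℝ (Fin 2)) 1) → V}
    (Φ : Fin m → ℝ → (Metric.sphere (0 : EuclideanSpace ℝ (Fin 2)) 1) → V)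
    (h1 : ∀ i, ContMDiff (𝓘(ℝ, ℝ).prod (𝓡 1)) (𝓡 n) ∞ (uncurry (Φ i)))
    (h2 : ∀ i t, Manifold.IsSmoothEmbedding (𝓡 1) (𝓡 n) ∞ (Φ i t))
    (h3 : ∀ i, Φ i 0 = e₀ i)
    (h4 : ∀ t i j, i ≠ j → ∀ u u', Φ i t u ≠ Φ j t u')
    (k : Fin m) {f e' : (Metric.sphere (0 : EuclideanSpace ℝ (Fin 2)) 1) → V} (hf : Φ k 1 = f)
    (F : SmoothIsotopy (𝓡 1) (𝓡 n) f e')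
    (hF : ∀ s u j, j ≠ k → ∀ u', F.toFun s u ≠ Φ j 1 u') :
    ∃ Φ' : Fin m → ℝ → (Metric.sphere (0 : EuclideanSpace ℝ (Fin 2)) 1) → V,
      (∀ i, ContMDiff (𝓘(ℝ, ℝ).prod (𝓡 1)) (𝓡 n) ∞ (uncurry (Φ' i))) ∧
      (∀ i t, Manifold.IsSmoothEmbedding (𝓡 1) (𝓡 n) ∞ (Φ' i t)) ∧
      (∀ i, Φ' i 0 = e₀ i) ∧
      (∀ t i j, i ≠ j → ∀ u u', Φ' i t u ≠ Φ' j t u') ∧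
      (∀ i, i ≠ k → Φ' i 1 = Φ i 1) ∧ Φ' k 1 = e' := by
  classical
  -- the pieces as smooth isotopies
  obtain ⟨Ik, hIk⟩ := exists_smoothIsotopy_of_family (Φ k) (h1 k) (h2 k) (h3 k) hf
  have hI : ∀ i, ∃ I : SmoothIsotopy (𝓡 1) (𝓡 n) (e₀ i) (Φ i 1), I.toFun = Φ i := fun i =>
    exists_smoothIsotopy_of_family (Φ i) (h1 i) (h2 i) (h3 i) rfl
  choose I hIΦ using hI
  set T : SmoothIsotopy (𝓡 1) (𝓡 n) (e₀ k) e' := Ik.trans F with hT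
  set S : ∀ i, SmoothIsotopy (𝓡 1) (𝓡 n) (e₀ i) (Φ i 1) := fun i =>
    (I i).trans (SmoothIsotopy.refl (h2 i 1)) with hS
  -- the stages of the new families, read off the clock of `trans`
  have stage : ∀ i (t : ℝ), (if i = k then T.toFun else (S i).toFun) t =
      if t ≤ 1 / 2 then Φ i (concatStep₁ t)
      else (if i = k then F.toFun (concatStep₂ t) else Φ i 1) := by
    intro i t
    by_cases hik : i = k
    · rw [if_pos hik, hik, if_pos rfl]
      show (if t ≤ 1 / 2 then Ik.toFun (concatStep₁ t) else F.toFun (concatStep₂ t)) = _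
      rw [hIk]
    · rw [if_neg hik, if_neg hik]
      show (if t ≤ 1 / 2 then (I i).toFun (concatStep₁ t) else Φ i 1) = _
      rw [hIΦ]
  refine ⟨fun i => if i = k then T.toFun else (S i).toFun, fun i => ?_, fun i t => ?_, fun i => ?_,
    fun t i j hij u u' => ?_, fun i hik => ?_, ?_⟩
  · by_cases hik : i = k
    · simp only [if_pos hik]; exact T.contMDiff
    · simp only [if_neg hik]; exact (S i).contMDiff
  · by_cases hik : i = k
    · simp only [if_pos hik]; exact T.isSmoothEmbedding t
    · simp only [if_neg hik]; exact (S i).isSmoothEmbedding t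
  · by_cases hik : i = k
    · simp only [if_pos hik]; rw [T.map_zero, hik]
    · simp only [if_neg hik]; exact (S i).map_zero
  · -- disjointness of the stages, phase by phase
    intro heq
    have hi := congrFun (stage i t) u
    have hj := congrFun (stage j t) u'
    change (if i = k then T.toFun else (S i).toFun) t u =
      (if j = k then T.toFun else (S j).toFun) t u' at heq
    rw [hi, hj] at heq
    by_cases ht : t ≤ 1 / 2
    · rw [if_pos ht, if_pos ht] at heq
      exact h4 _ i j hij u u' heq
    · rw [if_neg ht, if_neg ht] at heq
      by_cases hik : i = k
      · have hjk : j ≠ k := fun h => hij (hik.trans h.symm)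
        rw [if_pos hik, if_neg hjk] at heq
        exact hF _ u j hjk u' heq
      · by_cases hjk : j = k
        · rw [if_neg hik, if_pos hjk] at heq
          exact hF _ u' i hik u heq.symm
        · rw [if_neg hik, if_neg hjk] at heq
          exact h4 1 i j hij u u' heq
  · simp only [if_neg hik]
    exact (S i).map_one
  · show (if k = k then T.toFun else (S k).toFun) 1 = e'
    rw [if_pos rfl]
    exact T.map_one

end Families

/-! ### The theorem -/

section Links

variable [T2Space V] [CompactSpace V] {m : ℕ}

/-- **Whitney (1936) for links: componentwise homotopic links of circles in a closed manifold of
dimension `≥ 4` are isotopic as links.**  Let `V` be a compact Hausdorff `n`-manifold without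
boundary, `4 ≤ n`, and `e₀ e₁ : Fin m → (S¹ → V)` two links — smooth embeddings with pairwise
disjoint images — with `e₀ i` homotopic to `e₁ i` for every `i`.  Then there are smooth
isotopies `Fᵢ` from `e₀ i` to `e₁ i` whose stages are pairwise disjoint at every time.
Proof: move the components one at a time (module docstring).
[cite: Whitney1936, §II Thm. 6 and §§8–9] [cite: MilnorHCobordism1965, Thm. 8.4 and Remark (PDF p. 56)] -/
theorem exists_smoothIsotopy_link_of_homotopic (hn : 4 ≤ n)
    (e₀ e₁ : Fin m → C(Metric.sphere (0 : EuclideanSpace ℝ (Fin 2)) 1, V))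
    (he₀ : ∀ i, Manifold.IsSmoothEmbedding (𝓡 1) (𝓡 n) ∞ (e₀ i))
    (he₁ : ∀ i, Manifold.IsSmoothEmbedding (𝓡 1) (𝓡 n) ∞ (e₁ i))
    (hd₀ : ∀ i j, i ≠ j → ∀ u u', e₀ i u ≠ e₀ j u')
    (hd₁ : ∀ i j, i ≠ j → ∀ u u', e₁ i u ≠ e₁ j u')
    (h : ∀ i, (e₀ i).Homotopic (e₁ i)) :
    ∃ F : ∀ i, SmoothIsotopy (𝓡 1) (𝓡 n) (e₀ i : (Metric.sphere (0 : EuclideanSpace ℝ (Fin 2)) 1) → V) (e₁ i),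
      ∀ t i j, i ≠ j → ∀ u u', (F i).toFun t u ≠ (F j).toFun t u' := by
  classical
  -- the invariant of the construction
  let Inv (Φ : Fin m → ℝ → (Metric.sphere (0 : EuclideanSpace ℝ (Fin 2)) 1) → V) : Prop :=
    (∀ i, ContMDiff (𝓘(ℝ, ℝ).prod (𝓡 1)) (𝓡 n) ∞ (uncurry (Φ i))) ∧
    (∀ i t, Manifold.IsSmoothEmbedding (𝓡 1) (𝓡 n) ∞ (Φ i t)) ∧
    (∀ i, Φ i 0 = e₀ i) ∧
    (∀ t i j, i ≠ j → ∀ u u', Φ i t u ≠ Φ j t u')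
  have hsmooth_cp : ∀ (g : (Metric.sphere (0 : EuclideanSpace ℝ (Fin 2)) 1) → V),
      Manifold.IsSmoothEmbedding (𝓡 1) (𝓡 n) ∞ g →
        ContMDiff 𝓘(ℝ, ℝ) (𝓡 n) ∞ (fun s => g (circlePoint s)) := fun g hg =>
    hg.contMDiff.comp contMDiff_circlePoint
  -- ### Stage A: generic perturbation of the components of `e₀`, one at a time
  have stageA : ∀ k : ℕ, k ≤ m → ∃ Φ, Inv Φ ∧
      (∀ i : Fin m, k ≤ i.val → Φ i 1 = e₀ i) ∧
      (∀ i : Fin m, i.val < k → ∀ j, j ≠ i → ∀ u s, Φ i 1 u ≠ e₁ j (circlePoint s)) := by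
    intro k
    induction k with
    | zero =>
      intro _
      refine ⟨fun i _ => e₀ i, ⟨fun i => (he₀ i).contMDiff.comp contMDiff_snd, fun i _ => he₀ i,
        fun i => rfl, fun t i j hij u u' => hd₀ i j hij u u'⟩, fun i _ => rfl, fun i hi => ?_⟩
      exact absurd hi (Nat.not_lt_zero _)
    | succ k ih =>
      intro hk
      obtain ⟨Φ, ⟨h1, h2, h3, h4⟩, h5, h6⟩ := ih (Nat.le_of_succ_le hk)
      set kk : Fin m := ⟨k, hk⟩ with hkk
      -- perturb the `k`-th component inside the complement of the others
      set U : Set V := (⋃ j ∈ ({j | j ≠ kk} : Set (Fin m)), range (Φ j 1))ᶜ with hU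
      have hUo : IsOpen U := by
        refine (Set.Finite.isClosed_biUnion (Set.toFinite _) fun j _ => ?_).isOpen_compl
        exact (isCompact_range (h2 j 1).isEmbedding.continuous).isClosed
      have heU : ∀ u, Φ kk 1 u ∈ U := fun u hu => by
        obtain ⟨j, hj, u', he⟩ := mem_iUnion₂.1 hu
        exact h4 1 j kk hj u' u he
      obtain ⟨e', F, hFU, he'⟩ := exists_smoothIsotopy_perturb_avoiding hn (h2 kk 1) hUo heU
        (γ := fun (j : {j : Fin m // j ≠ kk}) s => e₁ j (circlePoint s))
        (fun j => hsmooth_cp _ (he₁ j))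
      have hF : ∀ s u j, j ≠ kk → ∀ u', F.toFun s u ≠ Φ j 1 u' := fun s u j hj u' he =>
        hFU s u (mem_iUnion₂.2 ⟨j, hj, u', he.symm⟩)
      obtain ⟨Φ', h1', h2', h3', h4', h5', h6'⟩ := exists_link_phase_step Φ h1 h2 h3 h4 kk rfl F hF
      refine ⟨Φ', ⟨h1', h2', h3', h4'⟩, fun i hi => ?_, fun i hi j hj u s => ?_⟩
      · have hik : i ≠ kk := fun h => by rw [h] at hi; exact Nat.not_succ_le_self k hi
        rw [h5' i hik]
        exact h5 i (Nat.le_of_succ_le hi)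
      · rcases Nat.lt_succ_iff_lt_or_eq.1 hi with hi' | hi'
        · have hik : i ≠ kk := fun h => by rw [h] at hi'; exact lt_irrefl _ hi'
          rw [h5' i hik]
          exact h6 i hi' j hj u s
        · have hik : i = kk := Fin.ext hi'
          rw [hik] at hj ⊢
          rw [h6']
          exact he' u ⟨j, hj⟩ s
  obtain ⟨ΦA, ⟨hA1, hA2, hA3, hA4⟩, -, hA6⟩ := stageA m le_rfl
  -- the perturbed initial link `eg₀`
  set eg₀ : Fin m → (Metric.sphere (0 : EuclideanSpace ℝ (Fin 2)) 1) → V := fun i => ΦA i 1 with heg₀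
  have heg₀emb : ∀ i, Manifold.IsSmoothEmbedding (𝓡 1) (𝓡 n) ∞ (eg₀ i) := fun i => hA2 i 1
  have heg₀e₁ : ∀ i j, j ≠ i → ∀ u s, eg₀ i u ≠ e₁ j (circlePoint s) := fun i j hj u s =>
    hA6 i i.isLt j hj u s
  have heg₀hom : ∀ i, (⟨eg₀ i, (heg₀emb i).isEmbedding.continuous⟩ :
      C(Metric.sphere (0 : EuclideanSpace ℝ (Fin 2)) 1, V)).Homotopic (e₁ i) := fun i => by
    obtain ⟨I, hI⟩ := exists_smoothIsotopy_of_family (ΦA i) (hA1 i) (hA2 i) (hA3 i) rfl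
    have h01 := I.homotopic_mk (e₀ i).continuous (heg₀emb i).isEmbedding.continuous
    exact h01.symm.trans (h i)
  -- ### Stage B: move the components to `e₁`, one at a time
  have stageB : ∀ k : ℕ, k ≤ m → ∃ Φ, Inv Φ ∧
      (∀ i : Fin m, i.val < k → Φ i 1 = e₁ i) ∧
      (∀ i : Fin m, k ≤ i.val → Φ i 1 = eg₀ i) := by
    intro k
    induction k with
    | zero =>
      intro _
      exact ⟨ΦA, ⟨hA1, hA2, hA3, hA4⟩, fun i hi => absurd hi (Nat.not_lt_zero _), fun i _ => rfl⟩
    | succ k ih =>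
      intro hk
      obtain ⟨Φ, ⟨h1, h2, h3, h4⟩, h5, h6⟩ := ih (Nat.le_of_succ_le hk)
      set kk : Fin m := ⟨k, hk⟩ with hkk
      have hkk1 : Φ kk 1 = eg₀ kk := h6 kk le_rfl
      -- the endpoints avoid the current positions of the other components
      have hγ₀ : ∀ u (j : {j : Fin m // j ≠ kk}) (s : ℝ), eg₀ kk u ≠ Φ j 1 (circlePoint s) := by
        intro u j s
        rw [← hkk1]
        exact h4 1 kk j (Ne.symm j.2) u _
      have hγ₁ : ∀ u (j : {j : Fin m // j ≠ kk}) (s : ℝ), e₁ kk u ≠ Φ j 1 (circlePoint s) := by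
        intro u j s
        rcases lt_or_ge (j : Fin m).val k with hj | hj
        · rw [h5 j hj]
          exact hd₁ kk j (Ne.symm j.2) u _
        · rw [h6 j hj]
          obtain ⟨s₀, rfl⟩ := circlePoint_surjective u
          exact (heg₀e₁ j kk (Ne.symm j.2) (circlePoint s) s₀).symm
      -- Whitney's theorem for the `k`-th component, avoiding the others
      obtain ⟨F, hF⟩ := exists_smoothIsotopy_circle_of_homotopic_avoiding hn
        ⟨eg₀ kk, (heg₀emb kk).isEmbedding.continuous⟩ (e₁ kk) (heg₀emb kk) (he₁ kk) (heg₀hom kk)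
        (γ := fun (j : {j : Fin m // j ≠ kk}) s => Φ j 1 (circlePoint s))
        (fun j => hsmooth_cp _ (h2 j 1)) hγ₀ hγ₁
      have hF' : ∀ s u j, j ≠ kk → ∀ u', F.toFun s u ≠ Φ j 1 u' := by
        intro s u j hj u'
        obtain ⟨s', rfl⟩ := circlePoint_surjective u'
        exact hF s u ⟨j, hj⟩ s'
      obtain ⟨Φ', h1', h2', h3', h4', h5', h6'⟩ := exists_link_phase_step Φ h1 h2 h3 h4 kk hkk1 F hF'
      refine ⟨Φ', ⟨h1', h2', h3', h4'⟩, fun i hi => ?_, fun i hi => ?_⟩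
      · rcases Nat.lt_succ_iff_lt_or_eq.1 hi with hi' | hi'
        · have hik : i ≠ kk := fun h => by rw [h] at hi'; exact lt_irrefl _ hi'
          rw [h5' i hik]
          exact h5 i hi'
        · have hik : i = kk := Fin.ext hi'
          rw [hik]
          exact h6'
      · have hik : i ≠ kk := fun h => by rw [h] at hi; exact Nat.not_succ_le_self k hi
        rw [h5' i hik]
        exact h6 i (Nat.le_of_succ_le hi)
  obtain ⟨Φ, ⟨h1, h2, h3, h4⟩, h5, -⟩ := stageB m le_rfl
  -- ### packaging
  have hF : ∀ i, ∃ F : SmoothIsotopy (𝓡 1) (𝓡 n)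
      (e₀ i : (Metric.sphere (0 : EuclideanSpace ℝ (Fin 2)) 1) → V) (e₁ i), F.toFun = Φ i := fun i =>
    exists_smoothIsotopy_of_family (Φ i) (h1 i) (h2 i) (h3 i) (h5 i i.isLt)
  choose F hFΦ using hF
  refine ⟨F, fun t i j hij u u' => ?_⟩
  rw [hFΦ, hFΦ]
  exact h4 t i j hij u u'

end Links

end Literature.Topology.FourManifolds

end
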